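import Summits.HodgeConjecture.HodgeConjecture.Theorems.R90S5NonsplitXiLabelRigidUnramified  -- ★ p862024 (this seat): `nonsplitXiLabelRigid_unramified`, `eta_eq_one_of_isSpherical_constituent_of_nonsplit` (hypothesis-first `hur`)
import Literature.NumberTheory.Automorphic.HyperspecialUnitaryCartanAdicCompletion             -- ★ `unramifiedLocalConjDatum_adicCompletion` (a `σ_w`-fixed uniformiser at an unramified inert place)
import Literature.NumberTheory.Automorphic.SymplecticGroupCartanUnique                         -- ★ `CartanUnique.v_uniformizer_zpow`, `uniformizer_ne_zero`
import HarnessLib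

/-!
# R90-TF · S5 (Rogawski Ch. 13.3) — (LN) at an UNRAMIFIED non-split place: units-Hilbert-90 discharged, binder-free ξ-label rigidity

Cell `hodgecm-mathlib`, crux H413 (`stmt-HodgeConjecture-24833`, lane `--supports … --as helper`), route of record `HCCMUnconditional` (no route verbs;
count-neutral).  Programme R90-TF, section S5 = Ch. 13.3 (base `R90-C133`); seat K2E3-p29 (g2), DEAL #14 (LN) continued (R90-C133-plan (g0),
R90 bus 2026-09-04T16:14:29Z): the second file of the deal, discharging the hypothesis-first units-Hilbert-90 binder `hur` of ★
`R90S5NonsplitXiLabelRigidUnramified` (p862024) from «`v` unramified in `L`» (`Algebra.IsUnramifiedIn (𝓞 L) v.asIdeal`).  THEOREMS ONLY (no `def`,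
no instance, no notation, no named fact, no `sorry`); imports ★ only.  HONEST LABEL: HC_CM is proved only modulo the 7 printed citations
(2 remaining named inputs: hLiu418 = stmt-HodgeConjecture-24832, h413 = stmt-HodgeConjecture-24833) until rung 0 closes; local group theory, closes no socket.

THE MATHEMATICS.  `E_v = ∏_{w∣v} L_w` with `σ = c ⊗ 1`, `v` NON-SPLIT (every `w ∣ v` is `c`-fixed) and UNRAMIFIED in `L`.  Block Hilbert 90 (★
`F0P2oStubDictTorusChar.exists_quotConj_eq_of_nonsplit`) writes every `β ∈ E¹_v` as `x/σ(x)` for a unit `x`; since `v` is unramified there is a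
`σ_w`-FIXED uniformiser `ϖ_w` of `L_w` (★ `unramifiedLocalConjDatum_adicCompletion`), and `α := x · (ϖ_w^{ord_w x})_w` is a unit OF VALUATION ONE at
every `w` with `α/σ(α) = x/σ(x) = β`.  (For a RAMIFIED quadratic `L_w/L⁺_v` this fails: `[E¹_v : quotConj(units of valuation one)] = 2`.)  Feeding this
into ★ `nonsplitXiLabelRigid_unramified` gives the binder-free head: at an unramified non-split `v` with `μ` unramified, a `K_v`-spherical constituent
common to `i_G(χ_ξ)` and `i_G(χ_{ξ′})` forces `(η₁, η₂) = (η₁′, η₂′)` — indeed each label is `(1, 1)` («`ξ_v` unramified ⇔ `ξ_v = 1`» at a non-split `v`).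

* `exists_unit_quotConj_eq_of_isUnramifiedIn_of_nonsplit` — units-Hilbert-90 at an unramified non-split place (valuation currency).
* **`nonsplitXiLabelRigid_of_isUnramifiedIn`** — the (LN) head with `hur` discharged; `eta_eq_one_of_isSpherical_constituent_of_isUnramifiedIn`
  (`η₁ = 1 ∧ η₂ = 1` from ONE spherical constituent — the per-ξ form consumed by «`P` determines `ξ` at the unramified non-split places», 13.3.7).

## References
* [Rogawski1990] J. D. Rogawski, *Automorphic Representations of Unitary Groups in Three Variables*, Ann. of Math. Stud. 123 (1990): §12.2 pp. 173–174, §13.3.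
* [CasselsFrohlichANT1967] J. W. S. Cassels, A. Fröhlich (eds.), *Algebraic Number Theory* (1967), Ch. V §2.7 Prop. 5 (Hilbert 90); Ch. I §7 (unramified
  extensions: a uniformiser of the base is a uniformiser).
* [CartierCorvallis1979] P. Cartier, *Representations of 𝔭-adic groups: a survey*, PSPM 33.1 (1979), §IV.1.
-/

set_option autoImplicit false
-- the mandated namespace repeats `HodgeConjecture.HodgeConjecture`, as in every `Theorems/*.lean` of this sub-problem
set_option linter.dupNamespace false

noncomputable section

open NumberField IsDedekindDomain
open scoped Matrix MatrixGroups

open Literature.NumberTheory.Automorphic Literature.NumberTheory.Automorphic.UnitaryGroup Literature.NumberTheory.Rogawski1990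

namespace Summit.HodgeConjecture.HodgeConjecture.R90.S5

/-! ## Units-Hilbert-90 at an UNRAMIFIED non-split place, and the binder-free (LN) head -/

section Unramified

variable (L : Type) [Field L] [NumberField L] [IsCMField L] (v : HeightOneSpectrum (𝓞 ↥(maximalRealSubfield L)))
  (hv : ∀ w : PlacesOver L v, IsCMField.complexConj L • w.1 = w.1)

include hv

/-- **UNITS-HILBERT-90 at an UNRAMIFIED non-split place**: every `β ∈ E¹_v` is `α/σ(α)` for a unit `α` of `∏_{w∣v} L_w` OF VALUATION ONE at every `w` —
block Hilbert 90 (★ `exists_quotConj_eq_of_nonsplit`: `β = x/σ(x)`) and the rescaling `α = x · ϖ^{ord x}` by a `σ_w`-FIXED uniformiser `ϖ` of `L_w`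
(★ `unramifiedLocalConjDatum_adicCompletion`, available exactly because `v` is unramified in `L`), which does not change `x/σ(x)`.
[cite: CasselsFrohlichANT1967, Ch. V §2.7 Prop. 5] [cite: Rogawski1990, §12.2 p. 174] -/
theorem exists_unit_quotConj_eq_of_isUnramifiedIn_of_nonsplit (hunr : Algebra.IsUnramifiedIn (𝓞 L) v.asIdeal)
    (β : ↥(normOneUnits (conjLocal L (IsCMField.complexConj L) v))) :
    ∃ α : (LocalRing L v)ˣ, (∀ w : PlacesOver L v, Valued.v ((α : LocalRing L v) w) = 1) ∧
      quotConj (conjLocal L (IsCMField.complexConj L) v) (conjLocal_conjLocal_cm L v) α = β := by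
  haveI : Algebra.IsQuadraticExtension ↥(maximalRealSubfield L) L := IsCMField.isQuadraticExtension L
  have hc1 : IsCMField.complexConj L ≠ 1 := IsCMField.complexConj_ne_one L
  obtain ⟨x, hx⟩ := Cruxes.H413.F0P2oStubDictTorusChar.exists_quotConj_eq_of_nonsplit L v hv β
  -- a `σ_w`-fixed uniformiser at every (i.e. the) place `w ∣ v`
  choose ϖ hϖ using fun w : PlacesOver L v =>
    unramifiedLocalConjDatum_adicCompletion (IsCMField.complexConj L) hc1 v w (hv w) hunr
  -- the components of the unit `x` are non-zero
  have hx0 : ∀ w : PlacesOver L v, Valued.v ((x : LocalRing L v) w) ≠ 0 := fun w h0 => by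
    have h := congrFun (x.inv_mul) w
    rw [Pi.mul_apply, Pi.one_apply] at h
    have h' := congrArg Valued.v h
    rw [map_mul, h0, mul_zero, map_one] at h'
    exact zero_ne_one h'
  -- the rescaling factor `λ_w = ϖ_w ^ {ord_w x}` (a `σ`-fixed unit)
  let m : PlacesOver L v → ℤ := fun w => WithZero.log (Valued.v ((x : LocalRing L v) w))
  let lam : LocalRing L v := fun w => ϖ w ^ m w
  have hlam0 : ∀ w, lam w ≠ 0 := fun w => zpow_ne_zero _ (CartanUnique.uniformizer_ne_zero (hϖ w).vϖ)
  have hvlam : ∀ w, Valued.v (lam w) = WithZero.exp (-(m w)) := fun w => CartanUnique.v_uniformizer_zpow (hϖ w).vϖ (m w)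
  let Λ : (LocalRing L v)ˣ := MulEquiv.piUnits.symm fun w => Units.mk0 (lam w) (hlam0 w)
  have hΛ : ∀ w, (Λ : LocalRing L v) w = lam w := fun _ => rfl
  -- `σ(Λ) = Λ`
  have hσΛ : Units.map ((conjLocal L (IsCMField.complexConj L) v) : LocalRing L v →* LocalRing L v) Λ = Λ := by
    refine Units.ext (funext fun w => ?_)
    rw [Units.coe_map, MonoidHom.coe_coe, conjLocal_apply_eq_of_smul_eq (IsCMField.complexConj L) hc1 v w (hv w), hΛ]
    change galAdicCompletionMap (L := L) (IsCMField.complexConj L) (hv w) (ϖ w ^ m w) = ϖ w ^ m w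
    rw [map_zpow₀, (hϖ w).σϖ]
  refine ⟨x * Λ, fun w => ?_, ?_⟩
  · rw [Units.val_mul, Pi.mul_apply, map_mul, hΛ, hvlam, ← WithZero.exp_log (hx0 w), ← WithZero.exp_add, add_neg_cancel,
      WithZero.exp_zero]
  · rw [map_mul, hx, mul_eq_left]
    apply Subtype.ext
    rw [coe_quotConj, hσΛ, mul_inv_cancel]
    rfl

/-- **(LN) AT AN UNRAMIFIED NON-SPLIT PLACE, BINDER-FREE IN THE PLACE**: `v` non-split and unramified in `L` (`Algebra.IsUnramifiedIn (𝓞 L) v.asIdeal`), `μ`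
unramified; a class `c ∈ Irr(U(Φ₃)(L⁺_v))` that is a `K_v`-spherical constituent of both `i_G(χ_ξ)` and `i_G(χ_{ξ′})` forces `(η₁, η₂) = (η₁′, η₂′)`
(§3 with `hur` discharged by the previous theorem). [cite: Rogawski1990, §12.2 pp. 173–174; §13.3] [cite: CartierCorvallis1979, §IV.1] -/
theorem nonsplitXiLabelRigid_of_isUnramifiedIn (hunr : Algebra.IsUnramifiedIn (𝓞 L) v.asIdeal)
    (μ : (LocalRing L v)ˣ →* ℂˣ) (hμ : ∀ u : (LocalRing L v)ˣ, (∀ w : PlacesOver L v, Valued.v ((u : LocalRing L v) w) = 1) → μ u = 1)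
    {η₁ η₂ η₁' η₂' : ↥(normOneUnits (conjLocal L (IsCMField.complexConj L) v)) →* ℂˣ} {c : IrrClass (Gqs L v)}
    (hc : c.IsConstituentOf (cmPrincipalSeries L 3 v (cmXiTorusChar L v μ η₁ η₂)))
    (hc' : c.IsConstituentOf (cmPrincipalSeries L 3 v (cmXiTorusChar L v μ η₁' η₂')))
    (hK : c.IsSpherical (cmLocalIntegralLevel L 3 (qsForm L) v)) : η₁ = η₁' ∧ η₂ = η₂' :=
  nonsplitXiLabelRigid_unramified L v hv (exists_unit_quotConj_eq_of_isUnramifiedIn_of_nonsplit L v hv hunr) μ hμ hc hc' hK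

/-- **A `K_v`-SPHERICAL CONSTITUENT OF `i_G(χ_ξ)` FORCES `ξ_v = 1`** at an unramified non-split place (`μ` unramified): `η₁ = 1 ∧ η₂ = 1` — the form in which
«`P` determines `ξ` at the unramified non-split places» is consumed (each ξ separately). [cite: Rogawski1990, §12.2 pp. 173–174; §13.3] -/
theorem eta_eq_one_of_isSpherical_constituent_of_isUnramifiedIn (hunr : Algebra.IsUnramifiedIn (𝓞 L) v.asIdeal)
    (μ : (LocalRing L v)ˣ →* ℂˣ) (hμ : ∀ u : (LocalRing L v)ˣ, (∀ w : PlacesOver L v, Valued.v ((u : LocalRing L v) w) = 1) → μ u = 1)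
    (η₁ η₂ : ↥(normOneUnits (conjLocal L (IsCMField.complexConj L) v)) →* ℂˣ) {c : IrrClass (Gqs L v)}
    (hc : c.IsConstituentOf (cmPrincipalSeries L 3 v (cmXiTorusChar L v μ η₁ η₂)))
    (hK : c.IsSpherical (cmLocalIntegralLevel L 3 (qsForm L) v)) : η₁ = 1 ∧ η₂ = 1 :=
  eta_eq_one_of_isSpherical_constituent_of_nonsplit L v hv (exists_unit_quotConj_eq_of_isUnramifiedIn_of_nonsplit L v hv hunr) μ hμ η₁ η₂ hc hK

end Unramified

end Summit.HodgeConjecture.HodgeConjecture.R90.S5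

end
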